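import Mathlib
import HarnessLib
import Literature.Analysis.FluidPDE.VectorCalculus
import Literature.Analysis.FluidPDE.AxisymHouLiVariables

/-!
# Route `HalfSpaceWindowDoor`, crux `CirculationCarryingRigidity` (stmt-NavierStokesRegularity-25311) — the EXACT DIVERGENCE
# STRUCTURE of the `e₃`-vorticity equation (pointwise identity; the "fine structure" named in the route's barrier section)

For the third component of the vorticity equation `∂ₜω + (u·∇)ω − (ω·∇)u = Δω` the transport-minus-stretching term is an
exact IN-PLANE divergence:

  `((u·∇)ω)₂ − ((ω·∇)u)₂ = ∂₀(u₀ω₂ − ω₀u₂) + ∂₁(u₁ω₂ − ω₁u₂)`   whenever `div u = 0` and `div ω = 0`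

(the `x₂`-flux `u₂ω₂ − ω₂u₂` of the antisymmetric tensor `u ⊗ ω − ω ⊗ u` vanishes identically; Majda–Bertozzi 2002 §1.1 /
§2.1: `(u·∇)ω − (ω·∇)u = div(u ⊗ ω − ω ⊗ u)` for divergence-free `u`, `ω`).  This is the algebraic reason why the flux of
`ω₂ = ⟪ω, e₃⟫` through horizontal planes obeys a one-dimensional heat law in (height, time) with an in-plane-divergence
source — the mechanism of the line `birth` of crux 25311 (SlicedKelvin's fold law in the zero-fold stratum).

* `convect_apply_eq_sum_three` — `((u·∇)w)ᵢ(x) = ∑ⱼ uⱼ(x) (∂ⱼw)ᵢ(x)` in the standard frame of `ℝ³`;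
* (tree `divergence_eq_sum_three`, `fderiv_apply_coord_vec3` of `AxisymHouLiVariables` — `div u = ∂₀u₀ + ∂₁u₁ + ∂₂u₂`);
* `convect_sub_stretch_two_eq_divh` — the displayed identity, for `u, ω : ℝ³ → ℝ³` differentiable at `x` with
  `div u (x) = div ω (x) = 0` (no relation `ω = curl u` is needed).

Pure calculus (Mathlib + `Literature.Analysis.FluidPDE.VectorCalculus` / `AxisymHouLiVariables` coordinate idioms).  Seat ns-hsw-p1 (LEAD of 25311, cell
pub-ns-dss).  WHAT THIS IS NOT: not a statement about Navier–Stokes regularity; a pointwise identity `--supports` the crux.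
-/

noncomputable section

-- the summit and its single sub-problem share the name (CONVENTIONS §1), as in every Theorems file
set_option linter.dupNamespace false

namespace Summit.NavierStokesRegularity.NavierStokesRegularity.Theorems.HalfSpaceWindowDoorCirculationCarryingRigidityTiltingIdentity

open scoped RealInnerProductSpace InnerProductSpace
open Literature.Analysis Literature.Analysis.FluidPDE

variable {u w : EuclideanSpace ℝ (Fin 3) → EuclideanSpace ℝ (Fin 3)} {x : EuclideanSpace ℝ (Fin 3)}

/-- A coordinate of a field differentiable at `x` is differentiable at `x`. -/
theorem differentiableAt_coord (hw : DifferentiableAt ℝ w x) (i : Fin 3) :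
    DifferentiableAt ℝ (fun y => w y i) x :=
  (EuclideanSpace.proj (𝕜 := ℝ) i).differentiableAt.comp x hw

/-- A vector of `ℝ³` in the standard frame: `h = h₀ e₀ + h₁ e₁ + h₂ e₂`. -/
theorem eq_sum_three_smul_single (h : EuclideanSpace ℝ (Fin 3)) :
    h = (h 0) • EuclideanSpace.single 0 (1 : ℝ) + (h 1) • EuclideanSpace.single 1 (1 : ℝ) +
      (h 2) • EuclideanSpace.single 2 (1 : ℝ) := by
  ext i
  fin_cases i <;> simp

/-- A linear map on `ℝ³` in the standard frame: `L h = h₀ L e₀ + h₁ L e₁ + h₂ L e₂`. -/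
theorem clm_apply_eq_sum_three {F : Type*} [NormedAddCommGroup F] [NormedSpace ℝ F]
    (L : EuclideanSpace ℝ (Fin 3) →L[ℝ] F) (h : EuclideanSpace ℝ (Fin 3)) :
    L h = (h 0) • L (EuclideanSpace.single 0 1) + (h 1) • L (EuclideanSpace.single 1 1) +
      (h 2) • L (EuclideanSpace.single 2 1) := by
  conv_lhs => rw [eq_sum_three_smul_single h]
  simp only [map_add, map_smul]

/-- **The convective derivative in the standard frame**: `((u·∇)w)ᵢ(x) = ∑ⱼ uⱼ(x) (Dw(x) eⱼ)ᵢ`. -/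
theorem convect_apply_eq_sum_three (u w : EuclideanSpace ℝ (Fin 3) → EuclideanSpace ℝ (Fin 3))
    (x : EuclideanSpace ℝ (Fin 3)) (i : Fin 3) :
    convect u w x i = u x 0 * fderiv ℝ w x (EuclideanSpace.single 0 1) i +
      u x 1 * fderiv ℝ w x (EuclideanSpace.single 1 1) i + u x 2 * fderiv ℝ w x (EuclideanSpace.single 2 1) i := by
  rw [convect_apply, clm_apply_eq_sum_three (fderiv ℝ w x) (u x)]
  simp

/-- Product rule for a flux component: `∂ₕ(uⱼ wᵢ)(x) = (Du(x)h)ⱼ wᵢ(x) + uⱼ(x) (Dw(x)h)ᵢ`. -/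
theorem fderiv_coord_mul_coord_apply (hu : DifferentiableAt ℝ u x) (hw : DifferentiableAt ℝ w x) (j i : Fin 3)
    (h : EuclideanSpace ℝ (Fin 3)) :
    fderiv ℝ (fun y => u y j * w y i) x h = fderiv ℝ u x h j * w x i + u x j * fderiv ℝ w x h i := by
  rw [fderiv_fun_mul (differentiableAt_coord hu j) (differentiableAt_coord hw i)]
  simp only [FunLike.coe_add, FunLike.coe_smul, Pi.add_apply, Pi.smul_apply, smul_eq_mul]
  rw [fderiv_apply_coord_vec3 hu, fderiv_apply_coord_vec3 hw]
  ring

/-- The flux component `y ↦ uⱼ wᵢ − wⱼ uᵢ` is differentiable at `x`. -/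
theorem differentiableAt_flux (hu : DifferentiableAt ℝ u x) (hw : DifferentiableAt ℝ w x) (j i : Fin 3) :
    DifferentiableAt ℝ (fun y => u y j * w y i - w y j * u y i) x :=
  ((differentiableAt_coord hu j).fun_mul (differentiableAt_coord hw i)).fun_sub
    ((differentiableAt_coord hw j).fun_mul (differentiableAt_coord hu i))

/-- Derivative of the flux component: `∂ₕ(uⱼwᵢ − wⱼuᵢ) = (Du h)ⱼ wᵢ + uⱼ (Dw h)ᵢ − (Dw h)ⱼ uᵢ − wⱼ (Du h)ᵢ`. -/
theorem fderiv_flux_apply (hu : DifferentiableAt ℝ u x) (hw : DifferentiableAt ℝ w x) (j i : Fin 3)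
    (h : EuclideanSpace ℝ (Fin 3)) :
    fderiv ℝ (fun y => u y j * w y i - w y j * u y i) x h =
      fderiv ℝ u x h j * w x i + u x j * fderiv ℝ w x h i -
        (fderiv ℝ w x h j * u x i + w x j * fderiv ℝ u x h i) := by
  rw [fderiv_fun_sub ((differentiableAt_coord hu j).fun_mul (differentiableAt_coord hw i))
    ((differentiableAt_coord hw j).fun_mul (differentiableAt_coord hu i)), FunLike.coe_sub,
    Pi.sub_apply, fderiv_coord_mul_coord_apply hu hw, fderiv_coord_mul_coord_apply hw hu]

/-- **THE DIVERGENCE STRUCTURE OF THE `e₃`-VORTICITY EQUATION** (pointwise).  For `u, ω : ℝ³ → ℝ³` differentiable at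
`x` with `div u (x) = 0` and `div ω (x) = 0`,

  `((u·∇)ω)₂(x) − ((ω·∇)u)₂(x) = ∂₀(u₀ω₂ − ω₀u₂)(x) + ∂₁(u₁ω₂ − ω₁u₂)(x)`:

transport minus stretching of the `e₃`-component is the in-plane divergence of the horizontal flux `u_h ω₂ − ω_h u₂`; the
vertical flux `u₂ω₂ − ω₂u₂` vanishes identically.  With `ω = curl u` (so `div ω = 0`) this is the `e₃`-component of
`(u·∇)ω − (ω·∇)u = div(u ⊗ ω − ω ⊗ u)` (Majda–Bertozzi 2002, §2.1). -/
theorem convect_sub_stretch_two_eq_divh (hu : DifferentiableAt ℝ u x) (hw : DifferentiableAt ℝ w x)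
    (hdivu : VectorCalculus.divergence u x = 0) (hdivw : VectorCalculus.divergence w x = 0) :
    convect u w x 2 - convect w u x 2 =
      fderiv ℝ (fun y => u y 0 * w y 2 - w y 0 * u y 2) x (EuclideanSpace.single 0 1) +
        fderiv ℝ (fun y => u y 1 * w y 2 - w y 1 * u y 2) x (EuclideanSpace.single 1 1) := by
  rw [convect_apply_eq_sum_three, convect_apply_eq_sum_three, fderiv_flux_apply hu hw, fderiv_flux_apply hu hw]
  rw [divergence_eq_sum_three] at hdivu hdivw
  linear_combination (u x 2) * hdivw - (w x 2) * hdivu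

/-- The same identity with the in-plane divergence written as a sum over the two horizontal directions. -/
theorem convect_sub_stretch_two_eq_sum (hu : DifferentiableAt ℝ u x) (hw : DifferentiableAt ℝ w x)
    (hdivu : VectorCalculus.divergence u x = 0) (hdivw : VectorCalculus.divergence w x = 0) :
    convect u w x 2 - convect w u x 2 =
      ∑ j : Fin 2, fderiv ℝ (fun y => u y (Fin.castSucc j) * w y 2 - w y (Fin.castSucc j) * u y 2) x
        (EuclideanSpace.single (Fin.castSucc j) 1) := by
  rw [convect_sub_stretch_two_eq_divh hu hw hdivu hdivw, Fin.sum_univ_two]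
  rfl

end Summit.NavierStokesRegularity.NavierStokesRegularity.Theorems.HalfSpaceWindowDoorCirculationCarryingRigidityTiltingIdentity

end
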